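import Literature.MathematicalPhysics.QuantumFieldTheory.Balaban1983to89.B1Eq324BenfattoSect5Iteration
import Literature.MathematicalPhysics.QuantumFieldTheory.Balaban1983to89.B1Eq324BenfattoSect5Pavements
import Literature.MathematicalPhysics.QuantumFieldTheory.Balaban1983to89.B1Eq324BenfattoAppendixA
import HarnessLib

/-!
# `Balaban1983to89.B1Eq324BenfattoSect5Termination` — [BenfattoEtAl1978] §5 p. 154 / p. 159: THE END OF THE ITERATION — after `d + 1` displaced
# pavements the surviving region is EMPTY (the corridor networks `Γ̄₁` of width `2w + v` have no common site), the «trivial case H_J = 0» is the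
# small-field volume of Appendix A, and the per-step factors CHAIN — PROVED for the tree's objects

statement-level skeleton of published theorems with citation tags; proofs where landed; nothing here is a claim about the
Yang–Mills mass gap

WHY THIS MODULE (cell `pub-ymgap`, seat `dag-n08-d` gen 9, INTENT-32; node N08 [Balaban1985UV3]; the [BenfattoEtAl1978] source chain behind the
(α)-row `h324c`; layer 3 «pavement iteration» of the assembly census `N08-BCG-ASSEMBLY-MAP.md` v1 item (4), skeleton).  Print, p. 154 (render
`lit-balaban-typer/renders/benfatto1978-cmp59/bcg_p154_s3.png`, read first-hand): *"After (d+1) steps one can obviously manage by suitably choosing the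
successive displaced pavements so that (J∩Γ₁)∩Γ₂∩…∩Γ_{d+1} = ∅ thereby reducing the proof of the lemma to the trivial case H_J = 0."*; p. 159:
*"Collecting all the errors made in this process (4.7) is proven."*  With `…Sect5PavementStep.pavementStep` (one step: the (4.7)-integral of
`(J, I, A, b)` dominates `e^{E}` times the one of `(J ∩ Γ̄₁, I, A|_{Γ̄₁}, γb)`) and `…Sect5Iteration.integral_cutoffBoltzmann_translate` (a displaced pavement
is the standard one for the translated datum), the iteration needs three more facts, typed here: the surviving region after `d + 1` suitably displaced
steps is empty (§2, on `Γ̄₁ = Γ₁∪Γ₂∪Γ₄` of depth `< 2w + v`, by `…Sect5Pavements.not_forall_inCorridor` at width `2w + v`), the terminal integral is the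
small-field volume `P̂₀(Π_Δχ̂^c_Δ)` bounded below by Appendix A (§1), and the step inequalities chain (§3).

WHAT IS PROVED (standard axioms; no `sorry`; no definition).
* §1 THE TRIVIAL CASE `H_J = 0`: `hamiltonian_empty` (`H^A_∅ = 0`), ★ `integral_cutoffBoltzmann_empty` (`∫ cutoffBoltzmann (hamiltonian s D ϰ A ∅) I c dP̂₀ =
  P̂₀.real(Π_Δχ̂^c_Δ)`), ★ `exists_integral_cutoffBoltzmann_empty_ge` (Appendix A by name, `…AppendixA.appendixALemma_of_pos`: `∃ b̄ k₁ k₂, ∀ c > b̄, ∀ I ≠ ∅,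
  exp(−|I|·k₁e^{−k₂c²}) ≤ ∫ cutoffBoltzmann (hamiltonian s D ϰ A ∅) I c dP̂₀`).
* §2 TERMINATION ON `Γ̄₁`: `not_mem_shrink_of_mem_corridorsBar` (a site of `Γ̄₁(B)` is at depth `< 2w + v` in its tessera), `inCorridor_of_mem_corridorsBar`
  (`⇒ InCorridor L (2w+v) 0 x`), `inCorridor_of_sub_mem_corridorsBar` (displaced pavement: `x − s ∈ Γ̄₁(B) ⇒ InCorridor L (2w+v) s x`), ★★
  `not_forall_sub_mem_corridorsBar` / `filter_forall_sub_mem_corridorsBar_eq_empty` — for `d + 1` shifts pairwise `≥ 2(2w+v)` away from `Lℤ` in every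
  coordinate, NO site survives all `d + 1` networks: `J ∩ ⋂_k (Γ̄₁(B_k) + s_k) = ∅`.
* §3 CHAINING: ★ `exp_sum_mul_le_of_steps` (`e^{E_k}·Z_{k+1} ≤ Z_k` for `k < n` ⇒ `e^{Σ_{k<n}E_k}·Z_n ≤ Z_0`).
HONEST SCOPE.  The identification of the accumulated exponents `Σ_k E_k` with `[Σ_{j≤t} Ê₀^T(H_J;j)/j!] − |I|·S(…)` of (4.7) (the cumulant side) and the
constants `S, ϱ₁…ϱ₄, b*` are NOT here; count-neutral for N08; `BasicLemmaPrinted` NOT discharged; nothing about d = 4, the continuum, OS axioms,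
a mass gap or the Clay problem.
-/

noncomputable section

open Finset MeasureTheory
open scoped BigOperators

namespace Literature.MathematicalPhysics.QuantumFieldTheory.Balaban1983to89.B1Eq324BenfattoSect5Termination

open _root_.MeasureTheory
open Literature.MathematicalPhysics.QuantumFieldTheory.Balaban1983to89.B1Eq324BenfattoLemma
open Literature.MathematicalPhysics.QuantumFieldTheory.Balaban1983to89.B1Eq324BenfattoSect5Boxes
open Literature.MathematicalPhysics.QuantumFieldTheory.Balaban1983to89.B1Eq324BenfattoSect5Eq511
open Literature.MathematicalPhysics.QuantumFieldTheory.Balaban1983to89.B1Eq324BenfattoSect5Eq524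
open Literature.MathematicalPhysics.QuantumFieldTheory.Balaban1983to89.B1Eq324BenfattoSect5Eq534
open Literature.MathematicalPhysics.QuantumFieldTheory.Balaban1983to89.B1Eq324BenfattoSect5Iteration
open Literature.MathematicalPhysics.QuantumFieldTheory.Balaban1983to89.B1Eq324BenfattoSect5Pavements
open Literature.MathematicalPhysics.QuantumFieldTheory.Balaban1983to89.B1Eq324BenfattoAppendixA (appendixALemma_of_pos)

variable {d : ℕ}

/-! ## §1  The trivial case `H_J = 0`: the terminal integral is the small-field volume of Appendix A -/

section Terminal

variable {α β : ℝ} {s D : ℕ} {κ : ℝ}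

/-- **`H^A_∅ = 0`**: the Hamiltonian of the empty region has no tuple (every degree `p ≥ 1`). [cite: BenfattoEtAl1978, (4.5) p.152, p.154 «the trivial case H_J = 0»] -/
theorem hamiltonian_empty (a : Coef d) (z : B1Eq324BenfattoLemma.Site d → ℝ) :
    hamiltonian s D κ a (∅ : Finset (B1Eq324BenfattoLemma.Site d)) z = 0 := by
  unfold hamiltonian
  refine Finset.sum_eq_zero fun p hp => ?_
  have hp1 : 0 < p := (Finset.mem_Icc.mp hp).1
  haveI : IsEmpty (Fin p → (∅ : Finset (B1Eq324BenfattoLemma.Site d))) :=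
    ⟨fun Δ => (Finset.notMem_empty _ (Δ ⟨0, hp1⟩).2).elim⟩
  exact Finset.sum_eq_zero fun Δ _ => (IsEmpty.false Δ).elim

/-- **The terminal integral IS the small-field volume**: `∫ cutoffBoltzmann (hamiltonian s D ϰ A ∅) I c dP̂₀ = P̂₀.real(Π_Δχ̂^c_Δ)` («the trivial case
H_J = 0», p. 154). [cite: BenfattoEtAl1978, §5 p.154; Appendix A (A.1) p.161] -/
theorem integral_cutoffBoltzmann_empty (a : Coef d) (I : Finset (B1Eq324BenfattoLemma.Site d)) (c : ℝ) :
    ∫ z, cutoffBoltzmann (hamiltonian s D κ a (∅ : Finset (B1Eq324BenfattoLemma.Site d))) I c z ∂P0 d α β = (P0 d α β).real (smallFieldSet I c) := by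
  have h : (cutoffBoltzmann (hamiltonian s D κ a (∅ : Finset (B1Eq324BenfattoLemma.Site d))) I c) =
      (smallFieldSet I c).indicator (fun _ => (1 : ℝ)) := by
    funext z
    simp only [cutoffBoltzmann, hamiltonian_empty, Real.exp_zero]
  rw [h]
  exact integral_indicator_one (measurableSet_smallFieldSet I c)

/-- **Appendix A bounds the terminal integral from below**: `∃ b̄ k₁ k₂, ∀ c > b̄, ∀ I ≠ ∅, exp(−|I|·k₁e^{−k₂c²}) ≤ ∫ cutoffBoltzmann (hamiltonian s D ϰ A ∅) I c dP̂₀`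
(`…AppendixA.appendixALemma_of_pos`, the Lemma of Appendix A proved in the tree for every `α, β > 0`). [cite: BenfattoEtAl1978, Appendix A (A.1)–(A.2) p.161; §5 p.159] -/
theorem exists_integral_cutoffBoltzmann_empty_ge (hα : 0 < α) (hβ : 0 < β) (a : Coef d) :
    ∃ bbar k₁ k₂ : ℝ, ∀ c : ℝ, bbar < c → ∀ I : Finset (B1Eq324BenfattoLemma.Site d), I.Nonempty →
      Real.exp (-((I.card : ℝ) * (k₁ * Real.exp (-(k₂ * c ^ 2))))) ≤
        ∫ z, cutoffBoltzmann (hamiltonian s D κ a (∅ : Finset (B1Eq324BenfattoLemma.Site d))) I c z ∂P0 d α β := by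
  obtain ⟨bbar, k₁, k₂, h⟩ := appendixALemma_of_pos (d := d) hα hβ
  refine ⟨bbar, k₁, k₂, fun c hc I hI => ?_⟩
  rw [integral_cutoffBoltzmann_empty]
  exact h c hc I hI

end Terminal

/-! ## §2  Termination on `Γ̄₁`: the networks of `d + 1` suitably displaced pavements have no common site -/

section Geometry

variable {L w v : ℕ} {B : Finset (B1Eq324BenfattoLemma.Site d)}

/-- **A site of `Γ̄₁(B)` is at depth `< 2w + v` in its own tessera** (`Γ₁(□)`: depth `< w`; `Γ₂(□)`: `< 2w`; `Γ₄(□)`: `< 2w + v`).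
[cite: BenfattoEtAl1978, (5.7) p.154, (5.27) p.157, (5.34) p.159] -/
theorem not_mem_shrink_of_mem_corridorsBar (hL : 0 < L) {x : B1Eq324BenfattoLemma.Site d} (hx : x ∈ corridorsBar L w v B) :
    x ∉ shrink L (boxIndex L x) (2 * w + v) := by
  intro hxs
  rw [corridorsBar, Finset.mem_union, corridors, Finset.mem_biUnion, Finset.mem_biUnion] at hx
  rcases hx with ⟨m, -, hm⟩ | ⟨m, -, hm⟩
  · -- `x ∈ Γ₁(□_m)`: `m` is the box index of `x`, and `x ∉ shrink w ⊇ shrink (2w + v)`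
    have hxb : x ∈ box L m := by rw [frame1] at hm; exact Finset.sdiff_subset hm
    have hmi : boxIndex L x = m := boxIndex_eq_of_mem_box hL hxb
    rw [hmi] at hxs
    rw [frame1, Finset.mem_sdiff] at hm
    exact hm.2 (shrink_mono L m (by omega) hxs)
  · have hxb : x ∈ box L m := frame2_union_frame4_subset_box L w v m hm
    have hmi : boxIndex L x = m := boxIndex_eq_of_mem_box hL hxb
    rw [hmi] at hxs
    rcases Finset.mem_union.mp hm with h2 | h4
    · rw [frame2, Finset.mem_sdiff] at h2
      exact h2.2 (shrink_mono L m (by omega) hxs)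
    · rw [frame4, annulus, Finset.mem_sdiff] at h4
      exact h4.2 hxs

/-- **`Γ̄₁(B)` lies in the width-`(2w+v)` corridor network of the standard pavement** (`…Sect5Pavements.InCorridor L (2w+v) 0`).
[cite: BenfattoEtAl1978, §5 p.154, (5.34) p.159] -/
theorem inCorridor_of_mem_corridorsBar (hL : 0 < L) {x : B1Eq324BenfattoLemma.Site d} (hx : x ∈ corridorsBar L w v B) :
    InCorridor L (2 * w + v) 0 x := by
  rw [inCorridor_zero_iff hL, frame1, Finset.mem_sdiff]
  exact ⟨mem_box_boxIndex hL x, not_mem_shrink_of_mem_corridorsBar hL hx⟩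

/-- **Displaced pavement**: if `x − s ∈ Γ̄₁(B)` (the network of the pavement displaced by `s`), then `InCorridor L (2w+v) s x`.
[cite: BenfattoEtAl1978, §5 p.154, p.159] -/
theorem inCorridor_of_sub_mem_corridorsBar (hL : 0 < L) {x s : B1Eq324BenfattoLemma.Site d} (hx : x - s ∈ corridorsBar L w v B) :
    InCorridor L (2 * w + v) s x := by
  have h := inCorridor_of_mem_corridorsBar hL hx
  simp only [InCorridor, Pi.sub_apply, Pi.zero_apply, sub_zero] at h ⊢
  exact h

/-- **«(J∩Γ₁)∩Γ₂∩…∩Γ_{d+1} = ∅» ON THE NETWORKS `Γ̄₁`**: for `d + 1` shifts `s_k` pairwise at distance `≥ 2(2w+v)` from `Lℤ` in every coordinate and any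
families of tesserae `B_k`, no site `x` has `x − s_k ∈ Γ̄₁(B_k)` for all `k` (`…Sect5Pavements.not_forall_inCorridor` at width `2w + v`).
[cite: BenfattoEtAl1978, §5 p.154, p.159] -/
theorem not_forall_sub_mem_corridorsBar (hL : 0 < L) (s : Fin (d + 1) → B1Eq324BenfattoLemma.Site d) (Bk : Fin (d + 1) → Finset (B1Eq324BenfattoLemma.Site d))
    (hsep : ∀ k k' : Fin (d + 1), k ≠ k' → ∀ (i : Fin d) (q : ℤ), (2 * (2 * w + v : ℕ) : ℤ) ≤ |s k i - s k' i - q * L|)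
    (x : B1Eq324BenfattoLemma.Site d) : ¬ ∀ k, x - s k ∈ corridorsBar L w v (Bk k) := fun h =>
  not_forall_inCorridor hL s hsep x fun k => inCorridor_of_sub_mem_corridorsBar hL (h k)

/-- **Finset form**: the sites of `J` surviving all `d + 1` steps form the empty set. [cite: BenfattoEtAl1978, §5 p.154, p.159] -/
theorem filter_forall_sub_mem_corridorsBar_eq_empty (hL : 0 < L) (s : Fin (d + 1) → B1Eq324BenfattoLemma.Site d)
    (Bk : Fin (d + 1) → Finset (B1Eq324BenfattoLemma.Site d))
    (hsep : ∀ k k' : Fin (d + 1), k ≠ k' → ∀ (i : Fin d) (q : ℤ), (2 * (2 * w + v : ℕ) : ℤ) ≤ |s k i - s k' i - q * L|)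
    (J : Finset (B1Eq324BenfattoLemma.Site d)) [DecidablePred fun x : B1Eq324BenfattoLemma.Site d => ∀ k, x - s k ∈ corridorsBar L w v (Bk k)] :
    J.filter (fun x => ∀ k, x - s k ∈ corridorsBar L w v (Bk k)) = ∅ :=
  Finset.filter_eq_empty_iff.mpr fun x _ => not_forall_sub_mem_corridorsBar hL s Bk hsep x

end Geometry

/-! ## §3  Chaining the steps -/

section Chain

/-- **«Collecting all the errors made in this process»** — the step inequalities chain: if `e^{E_k}·Z_{k+1} ≤ Z_k` for every `k < n`, then
`e^{Σ_{k<n}E_k}·Z_n ≤ Z_0` (the `Z_k` are the (4.7)-integrals of the successive data, `E_k = −err₅₁₁ − err₅₃₄ + Σ_□ℓ_□` of `pavementStep`).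
[cite: BenfattoEtAl1978, §5 p.159] -/
theorem exp_sum_mul_le_of_steps (Z E : ℕ → ℝ) :
    ∀ n : ℕ, (∀ k < n, Real.exp (E k) * Z (k + 1) ≤ Z k) → Real.exp (∑ k ∈ Finset.range n, E k) * Z n ≤ Z 0 := by
  intro n
  induction n with
  | zero =>
    intro _
    simp
  | succ n ih =>
    intro h
    rw [Finset.sum_range_succ, Real.exp_add]
    calc Real.exp (∑ k ∈ Finset.range n, E k) * Real.exp (E n) * Z (n + 1)
        = Real.exp (∑ k ∈ Finset.range n, E k) * (Real.exp (E n) * Z (n + 1)) := by ring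
      _ ≤ Real.exp (∑ k ∈ Finset.range n, E k) * Z n :=
        mul_le_mul_of_nonneg_left (h n (Nat.lt_succ_self n)) (Real.exp_pos _).le
      _ ≤ Z 0 := ih fun k hk => h k (Nat.lt_succ_of_lt hk)

end Chain

end Literature.MathematicalPhysics.QuantumFieldTheory.Balaban1983to89.B1Eq324BenfattoSect5Termination

end
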